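import Mathlib.Algebra.Order.BigOperators.Group.Finset
import Mathlib.Algebra.BigOperators.Ring.Finset
import Mathlib.Algebra.Order.Field.Basic
import Mathlib.Analysis.Normed.Field.Basic
import HarnessLib

/-!
# Screening recursion for `SAWCircleScreening`, part II: the abstract one-scale coupling step

Route `SAWCircleScreening` of `CriticalPhenomena/SAWScalingLimit`, support item
`ScreeningRecursion` (stmt-CriticalPhenomena-5468). This file isolates the finite-probability
heart of the multi-scale argument (Garban–Pete–Schramm 2013, §3, proof of Prop. 11; Masson
2009, Thm 4.7) as a statement about two probability vectors `p`, `p'` on finite types: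

* a *proxy screen* `sc` and a *true screen* `s` (values in `Option S`) agree off a *bad* event
  `R` of mass `≤ η` (no deep return);
* **exact screen**: conditionally on the true screen `s = some v`, the observable `Φ` has a law
  `q v` which is THE SAME for `p` and `p'`;
* **Markov**: conditionally on the proxy screen, the law of `Φ` is a mixture of laws `μ x`,
  resp. `ν x'`, any two of which are `d`-close;
* **overlap**: `∑_v min (p(s = v), p'(s' = v)) ≥ c₁`.

Then (`abstract_step`, in part IIb `…TVStep`) `|p(Φ ∈ A) - p'(Φ' ∈ A)| ≤ 4η + (1 - c₁ + 4η) d`.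
This part contains the finite-sum tools: fibrewise summation over an `Option`-valued screen
(`sum_mul_apply_eq_sum_fiberMass`), the mixture lemma (`abs_sum_mul_sub_sum_mul_le`), sums
supported on a bad event (`sum_le_of_support_bad`) and the proxy/true fibre-mass discrepancy
(`sum_abs_fiberMass_sub_le`). Everything is elementary algebra of finite sums.
-/

open Finset

namespace Summit.CriticalPhenomena.SAWScalingLimit.Theorems.ScreeningRecursion.Abstract

variable {X S : Type*} [Fintype X] [DecidableEq S]

/-! ## Fibrewise sums over an `Option`-valued map -/

omit [DecidableEq S] in
/-- Fibre masses `p(f = some v)` of a nonnegative weight are nonnegative. [folklore] -/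
theorem fiberMass_nonneg {p : X → ℝ} (hp : ∀ x, 0 ≤ p x) (f : X → Option S) (v : S)
    [DecidablePred fun x => f x = some v] :
    0 ≤ ∑ x ∈ univ.filter (fun x => f x = some v), p x :=
  sum_nonneg fun x _ => hp x

/-- **Fibrewise summation**: a sum of `p x · g (f x)` with `g none = 0` is the sum over the
values `v` of the fibre masses times `g (some v)`, over any finite set `V` containing all values.
[folklore] -/
theorem sum_mul_apply_eq_sum_fiberMass (p : X → ℝ) (f : X → Option S) (V : Finset S)
    (hV : ∀ x v, f x = some v → v ∈ V) (g : Option S → ℝ) (hg : g none = 0) :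
    ∑ x, p x * g (f x) = ∑ v ∈ V, (∑ x ∈ univ.filter (fun x => f x = some v), p x) * g (some v) := by
  classical
  have h1 : ∀ x, p x * g (f x) = ∑ v ∈ V, if f x = some v then p x * g (some v) else 0 := by
    intro x
    cases hfx : f x with
    | none =>
      rw [hg, mul_zero]
      symm
      exact sum_eq_zero fun v _ => by simp
    | some v₀ =>
      have hv₀ : v₀ ∈ V := hV x v₀ hfx
      symm
      rw [Finset.sum_eq_single v₀]
      · rw [if_pos rfl]
      · intro v _ hv
        rw [if_neg]
        simpa using (Ne.symm hv)
      · intro h; exact absurd hv₀ h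
  simp_rw [h1]
  rw [sum_comm]
  refine sum_congr rfl fun v _ => ?_
  rw [sum_filter, sum_mul]
  refine sum_congr rfl fun x _ => ?_
  split_ifs <;> simp

/-! ## The mixture lemma -/

omit [DecidableEq S] in
/-- **Mixture lemma.** Two mixtures `∑ a x · μ x` and `∑ a' x' · ν x'` with nonnegative weights
of the same total mass `q`, of quantities any two of which are `d`-close (`d ≥ 0`), are
`q d`-close. [folklore] -/
theorem abs_sum_mul_sub_sum_mul_le {X' : Type*} [Fintype X'] (a : X → ℝ) (a' : X' → ℝ)
    (μ : X → ℝ) (ν : X' → ℝ) (ha : ∀ x, 0 ≤ a x) (ha' : ∀ x, 0 ≤ a' x) {q d : ℝ}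
    (hq : ∑ x, a x = q) (hq' : ∑ x, a' x = q)
    (hclose : ∀ x x', 0 < a x → 0 < a' x' → |μ x - ν x'| ≤ d) :
    |∑ x, a x * μ x - ∑ x', a' x' * ν x'| ≤ q * d := by
  have hq0 : 0 ≤ q := hq ▸ sum_nonneg fun x _ => ha x
  rcases hq0.eq_or_lt with hq0 | hqpos
  · -- `q = 0`: all weights vanish
    have h1 : ∀ x, a x = 0 := fun x =>
      (sum_eq_zero_iff_of_nonneg (fun x _ => ha x)).1 (hq.trans hq0.symm) x (mem_univ _)
    have h2 : ∀ x, a' x = 0 := fun x =>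
      (sum_eq_zero_iff_of_nonneg (fun x _ => ha' x)).1 (hq'.trans hq0.symm) x (mem_univ _)
    simp [h1, h2, ← hq0]
  · -- `q > 0`: write the difference as a double sum
    have key : (∑ x, a x * μ x - ∑ x', a' x' * ν x') * q =
        ∑ x, ∑ x', a x * a' x' * (μ x - ν x') := by
      have e1 : (∑ x, a x * μ x) * q = ∑ x, ∑ x', a x * a' x' * μ x := by
        rw [← hq', sum_mul]
        refine sum_congr rfl fun x _ => ?_
        rw [mul_sum]
        refine sum_congr rfl fun x' _ => ?_
        ring
      have e2 : (∑ x', a' x' * ν x') * q = ∑ x, ∑ x', a x * a' x' * ν x' := by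
        rw [← hq, mul_comm, sum_mul]
        refine sum_congr rfl fun x _ => ?_
        rw [mul_sum]
        refine sum_congr rfl fun x' _ => ?_
        ring
      rw [sub_mul, e1, e2, ← sum_sub_distrib]
      refine sum_congr rfl fun x _ => ?_
      rw [← sum_sub_distrib]
      refine sum_congr rfl fun x' _ => ?_
      ring
    have hbound : |∑ x, ∑ x', a x * a' x' * (μ x - ν x')| ≤ ∑ x, ∑ x', a x * a' x' * d := by
      refine (abs_sum_le_sum_abs _ _).trans (sum_le_sum fun x _ => ?_)
      refine (abs_sum_le_sum_abs _ _).trans (sum_le_sum fun x' _ => ?_)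
      rw [abs_mul, abs_of_nonneg (mul_nonneg (ha x) (ha' x'))]
      rcases (ha x).eq_or_lt with h0 | hpos
      · rw [← h0]; simp
      rcases (ha' x').eq_or_lt with h0' | hpos'
      · rw [← h0']; simp
      exact mul_le_mul_of_nonneg_left (hclose x x' hpos hpos') (mul_nonneg (ha x) (ha' x'))
    have htot : ∑ x, ∑ x', a x * a' x' * d = q * q * d := by
      rw [show q * q * d = (∑ x, a x) * ((∑ x', a' x') * d) by rw [hq, hq']; ring, sum_mul]
      refine sum_congr rfl fun x _ => ?_
      rw [sum_mul, mul_sum]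
      refine sum_congr rfl fun x' _ => ?_
      ring
    rw [htot] at hbound
    rw [← key] at hbound
    rw [abs_mul, abs_of_pos hqpos] at hbound
    have : |∑ x, a x * μ x - ∑ x', a' x' * ν x'| * q ≤ (q * d) * q := by linarith
    exact le_of_mul_le_mul_right this hqpos

/-! ## The one-scale step -/

/-- Sums of nonnegative terms supported on a "bad" set of mass `≤ η`, each at most the weight,
are at most `η`. [folklore] -/
theorem sum_le_of_support_bad {p : X → ℝ} (hp : ∀ x, 0 ≤ p x) (R : X → Prop) [DecidablePred R]
    {η : ℝ} (hR : ∑ x ∈ univ.filter R, p x ≤ η) (F : X → ℝ) (hF0 : ∀ x, ¬ R x → F x = 0)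
    (hF1 : ∀ x, |F x| ≤ 1) : |∑ x, p x * F x| ≤ η := by
  refine (abs_sum_le_sum_abs _ _).trans ?_
  calc ∑ x, |p x * F x| ≤ ∑ x, (if R x then p x else 0) := by
        refine sum_le_sum fun x _ => ?_
        split_ifs with h
        · rw [abs_mul, abs_of_nonneg (hp x)]
          exact (mul_le_mul_of_nonneg_left (hF1 x) (hp x)).trans (by rw [mul_one])
        · rw [hF0 x h, mul_zero, abs_zero]
    _ = ∑ x ∈ univ.filter R, p x := (sum_filter R p).symm
    _ ≤ η := hR

/-- The screens differ from their proxies on a set of total fibre-mass discrepancy `≤ 2η`: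
`∑_v |p(sc = v) - p(s = v)| ≤ 2 p(R) ≤ 2η`. [folklore] -/
theorem sum_abs_fiberMass_sub_le {p : X → ℝ} (hp : ∀ x, 0 ≤ p x) (sc s : X → Option S)
    (R : X → Prop) [DecidablePred R] {η : ℝ} (hR : ∑ x ∈ univ.filter R, p x ≤ η)
    (hsc : ∀ x, ¬ R x → sc x = s x) (V : Finset S) :
    ∑ v ∈ V, |(∑ x ∈ univ.filter (fun x => sc x = some v), p x) - (∑ x ∈ univ.filter (fun x => s x = some v), p x)| ≤ 2 * η := by
  classical
  have h1 : ∀ v ∈ V, |(∑ x ∈ univ.filter (fun x => sc x = some v), p x) - (∑ x ∈ univ.filter (fun x => s x = some v), p x)| ≤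
      ∑ x, p x * |(if sc x = some v then (1 : ℝ) else 0) - (if s x = some v then 1 else 0)| := by
    intro v _
    have e : (∑ x ∈ univ.filter (fun x => sc x = some v), p x) - (∑ x ∈ univ.filter (fun x => s x = some v), p x) =
        ∑ x, p x * ((if sc x = some v then (1 : ℝ) else 0) - (if s x = some v then 1 else 0)) := by
      rw [sum_filter, sum_filter, ← sum_sub_distrib]
      refine sum_congr rfl fun x _ => ?_
      split_ifs <;> ring
    rw [e]
    refine (abs_sum_le_sum_abs _ _).trans (sum_le_sum fun x _ => ?_)
    rw [abs_mul, abs_of_nonneg (hp x)]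
  refine (sum_le_sum h1).trans ?_
  rw [sum_comm]
  -- for each `x` the inner sum over `v` is `0` off `R` and `≤ 2` on `R`
  have h2 : ∀ x, ∑ v ∈ V, p x * |(if sc x = some v then (1 : ℝ) else 0) -
      (if s x = some v then 1 else 0)| ≤ if R x then 2 * p x else 0 := by
    intro x
    rw [← mul_sum]
    split_ifs with hRx
    · rw [mul_comm]
      refine mul_le_mul_of_nonneg_right ?_ (hp x)
      calc ∑ v ∈ V, |(if sc x = some v then (1 : ℝ) else 0) - (if s x = some v then 1 else 0)|
          ≤ ∑ v ∈ V, ((if sc x = some v then (1 : ℝ) else 0) + (if s x = some v then 1 else 0)) := by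
            refine sum_le_sum fun v _ => ?_
            split_ifs <;> norm_num
        _ = (∑ v ∈ V, if sc x = some v then (1 : ℝ) else 0) +
              ∑ v ∈ V, (if s x = some v then (1 : ℝ) else 0) := sum_add_distrib
        _ ≤ 1 + 1 := by
            gcongr
            · cases hscx : sc x with
              | none => simp
              | some v₀ =>
                simp only [Option.some.injEq]
                rw [show (fun v => if v₀ = v then (1 : ℝ) else 0) = fun v => if v = v₀ then 1 else 0
                  from funext fun v => by simp [eq_comm]]
                rw [sum_ite_eq']; split_ifs <;> norm_num
            · cases hsx : s x with
              | none => simp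
              | some v₀ =>
                simp only [Option.some.injEq]
                rw [show (fun v => if v₀ = v then (1 : ℝ) else 0) = fun v => if v = v₀ then 1 else 0
                  from funext fun v => by simp [eq_comm]]
                rw [sum_ite_eq']; split_ifs <;> norm_num
        _ = 2 := by norm_num
    · have : ∀ v ∈ V, |(if sc x = some v then (1 : ℝ) else 0) - (if s x = some v then 1 else 0)| = 0 :=
        fun v _ => by rw [hsc x hRx, sub_self, abs_zero]
      rw [sum_congr rfl this, sum_const_zero, mul_zero]
  calc ∑ x, ∑ v ∈ V, p x * |(if sc x = some v then (1 : ℝ) else 0) - (if s x = some v then 1 else 0)|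
      ≤ ∑ x, (if R x then 2 * p x else 0) := sum_le_sum fun x _ => h2 x
    _ = 2 * ∑ x ∈ univ.filter R, p x := by
        rw [sum_filter, mul_sum]
        refine sum_congr rfl fun x _ => ?_
        split_ifs <;> ring
    _ ≤ 2 * η := by linarith

end Summit.CriticalPhenomena.SAWScalingLimit.Theorems.ScreeningRecursion.Abstract
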